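import Literature.NumberTheory.EllipticCurves.OpenImageMazurInputs
import HarnessLib

/-! # The five classes of `k` from Mazur's range — stub `stub_prop51_of_range` of line `Sketch`,
# crux `MazurKenkuBound` (stmt-ABC-15125)

WHAT. The purely arithmetic last step of B. Mazur, *Rational isogenies of prime degree* (1978),
proof of Prop. 5.1 (p. 151). The isogeny character `r` of a rational `N`-isogeny (`N = 11` or
`N ≥ 17` prime) is written `r = α · χ ^ k₀` with `α ^ 12 = 1` (`χ` the mod-`N` cyclotomic
character), and Raynaud's range gives `e k₀ ≡ j (mod N - 1)` for some `e ∈ {1, 2, 3, 4, 6}` and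
`0 ≤ j ≤ e`. CONCLUSION (`stub_prop51_of_range`): some `k` in one of the five classes
`k ≡ 0, 1, 1/2, 1/3, 2/3 (mod m)`, `m = (N - 1) / 2`, still has `r = α' · χ ^ k` with
`α' ^ 12 = 1`.

PROOF (complete case analysis; `N` is odd, `N - 1 = 2m`, `N - 1 ≥ 10 > 6 ≥ e`). Units of
`ZMod N` satisfy `u ^ (N - 1) = 1` (`ZMod.units_pow_card_sub_one_eq_one`), so
`(χ σ ^ t) ^ 12 = 1` as soon as `(N - 1) ∣ 12 t`, which lets one shift the exponent by such `t`
(`r = α χ^(t + k) = (α χ^t) χ^k`).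
* `j = 0`: `(N - 1) ∣ e k₀ ∣ 12 k₀` (as `e ∣ 12`); take `k = 0`, `α' = α · χ ^ k₀`.
* `j = e`: `k₀ ≥ 1` (else `(N - 1) ∣ e`, `0 < e < N - 1`), and `(N - 1) ∣ e (k₀ - 1) ∣ 12 (k₀ - 1)`;
  take `k = 1`, `α' = α · χ ^ (k₀ - 1)`.
* parity: `N - 1` even kills `(e, j) ∈ {(2,1), (4,1), (4,3), (6,1), (6,3), (6,5)}`
  (`e k₀ ≡ j (mod 2)` with `e` even, `j` odd).
* the rest, with `k = k₀`: `(3,1), (6,2) ↦ 3k ≡ 1`; `(3,2), (6,4) ↦ 3k ≡ 2`; `(4,2) ↦ 2k ≡ 1`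
  `(mod m)` (reduce `mod 2m` to `mod m`, or cancel the factor `2` in `2a ≡ 2b (mod 2m)`).
The Galois group plays no role: the helpers are stated for homomorphisms from any group `G`.
Nothing here is specific to elliptic curves; no named fact is used. -/

-- `Summit.<Summit>.<Problem>` is the mandated summit-side namespace (CONVENTIONS §2); for the
-- single-conjunct summit `ABC` the two coincide, so the duplicate `ABC.ABC` is deliberate.
set_option linter.dupNamespace false

noncomputable section

open Field

namespace Summit.ABC.ABC.Theorems

/-- A unit of `ZMod N`, `N` prime, raised to a multiple of `N - 1` is `1` (Fermat's little
theorem in the form `ZMod.units_pow_card_sub_one_eq_one`). [folklore] -/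
private theorem units_pow_eq_one_of_card_sub_one_dvd {N : ℕ} [Fact N.Prime] (u : (ZMod N)ˣ)
    {t : ℕ} (h : N - 1 ∣ t) : u ^ t = 1 := by
  obtain ⟨c, rfl⟩ := h
  rw [pow_mul, ZMod.units_pow_card_sub_one_eq_one, one_pow]

/-- Exponent shift: if `r = α · χ ^ k₀` pointwise with `α ^ 12 = 1`, `k₀ = t + k` and
`(N - 1) ∣ 12 t`, then `r = α' · χ ^ k` pointwise with `α' ^ 12 = 1` (namely `α' = α · χ ^ t`,
whose twelfth power is `χ ^ (12 t) = 1`). [folklore] -/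
private theorem twelfth_root_shift {N : ℕ} [Fact N.Prime] {G : Type*} [Group G]
    (r χ : G →* (ZMod N)ˣ) {k₀ t k : ℕ} (hk : k₀ = t + k) (ht : N - 1 ∣ 12 * t)
    (hr : ∀ σ : G, ∃ b : (ZMod N)ˣ, b ^ 12 = 1 ∧ r σ = b * χ σ ^ k₀) :
    ∀ σ : G, ∃ b : (ZMod N)ˣ, b ^ 12 = 1 ∧ r σ = b * χ σ ^ k := by
  intro σ
  obtain ⟨b, hb, hrσ⟩ := hr σ
  refine ⟨b * χ σ ^ t, ?_, ?_⟩
  · rw [mul_pow, hb, one_mul, ← pow_mul, Nat.mul_comm t 12]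
    exact units_pow_eq_one_of_card_sub_one_dvd _ ht
  · rw [hrσ, hk, pow_add, mul_assoc]

/-- Case `j = 0` of Mazur's range: `e k₀ ≡ 0 (mod N - 1)` with `e ∣ 12` gives
`(N - 1) ∣ 12 k₀`, hence the class `k ≡ 0` (with `k = 0`, `α' = α · χ ^ k₀`).
[cite: Mazur1978, proof of Prop. 5.1 (p. 151)] -/
private theorem prop51_class_zero {N : ℕ} [Fact N.Prime] {G : Type*} [Group G]
    (r χ : G →* (ZMod N)ˣ) {k₀ e m : ℕ} (he : e ∣ 12) (hmod : e * k₀ ≡ 0 [MOD N - 1])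
    (hr : ∀ σ : G, ∃ b : (ZMod N)ˣ, b ^ 12 = 1 ∧ r σ = b * χ σ ^ k₀) :
    ∃ k : ℕ, (k ≡ 0 [MOD m] ∨ k ≡ 1 [MOD m] ∨ 2 * k ≡ 1 [MOD m] ∨ 3 * k ≡ 1 [MOD m] ∨
        3 * k ≡ 2 [MOD m]) ∧
      ∀ σ : G, ∃ b : (ZMod N)ˣ, b ^ 12 = 1 ∧ r σ = b * χ σ ^ k :=
  ⟨0, Or.inl (Nat.ModEq.refl 0), twelfth_root_shift r χ (add_zero k₀).symm
    ((Nat.modEq_zero_iff_dvd.mp hmod).trans (mul_dvd_mul_right he k₀)) hr⟩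

/-- Case `j = e` of Mazur's range: `e k₀ ≡ e (mod N - 1)` with `e ∣ 12` and `0 < e < N - 1`
forces `k₀ ≥ 1` (else `(N - 1) ∣ e`) and gives `(N - 1) ∣ 12 (k₀ - 1)`, hence the class
`k ≡ 1` (with `k = 1`, `α' = α · χ ^ (k₀ - 1)`). [cite: Mazur1978, proof of Prop. 5.1 (p. 151)] -/
private theorem prop51_class_one {N : ℕ} [Fact N.Prime] {G : Type*} [Group G]
    (r χ : G →* (ZMod N)ˣ) {k₀ e m : ℕ} (he : e ∣ 12) (he0 : 0 < e) (heN : e < N - 1)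
    (hmod : e * k₀ ≡ e [MOD N - 1])
    (hr : ∀ σ : G, ∃ b : (ZMod N)ˣ, b ^ 12 = 1 ∧ r σ = b * χ σ ^ k₀) :
    ∃ k : ℕ, (k ≡ 0 [MOD m] ∨ k ≡ 1 [MOD m] ∨ 2 * k ≡ 1 [MOD m] ∨ 3 * k ≡ 1 [MOD m] ∨
        3 * k ≡ 2 [MOD m]) ∧
      ∀ σ : G, ∃ b : (ZMod N)ˣ, b ^ 12 = 1 ∧ r σ = b * χ σ ^ k := by
  cases k₀ with
  | zero =>
    rw [mul_zero] at hmod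
    exact absurd (Nat.le_of_dvd he0 (Nat.modEq_zero_iff_dvd.mp hmod.symm)) (not_le.mpr heN)
  | succ k =>
    have h0 : e * k ≡ 0 [MOD N - 1] := by
      refine Nat.ModEq.add_right_cancel' e ?_
      rwa [zero_add, ← mul_add_one]
    exact ⟨1, Or.inr (Or.inl (Nat.ModEq.refl 1)), twelfth_root_shift r χ (t := k) rfl
      ((Nat.modEq_zero_iff_dvd.mp h0).trans (mul_dvd_mul_right he k)) hr⟩

/-- Halving a congruence modulo `2m`: if `a ≡ b (mod 2m)` with `a = 2c`, `b = 2d`, then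
`c ≡ d (mod m)`. [folklore] -/
private theorem modEq_half_of_modEq_two_mul {a b c d m : ℕ} (h : a ≡ b [MOD 2 * m])
    (ha : a = 2 * c) (hb : b = 2 * d) : c ≡ d [MOD m] := by
  subst ha hb
  exact Nat.ModEq.mul_left_cancel' two_ne_zero h

/-- **Mazur 1978, end of the proof of Prop. 5.1 (p. 151): the five classes of `k` from the
range.** For `N = 11` or `N ≥ 17` prime and homomorphisms `r, χ` to `(ZMod N)ˣ` with
`r = α · χ ^ k₀` pointwise, `α ^ 12 = 1`: if `e k₀ ≡ j (mod N - 1)` for some `e ∈ {1, 2, 3, 4, 6}`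
and `0 ≤ j ≤ e`, then for some `k` with `k ≡ 0`, `k ≡ 1`, `2k ≡ 1`, `3k ≡ 1` or `3k ≡ 2`
`(mod (N - 1) / 2)` one still has `r = α' · χ ^ k` pointwise with `α' ^ 12 = 1`. Complete case
analysis on `(e, j)`: `j = 0 ↦ k = 0`; `j = e ↦ k = 1`; `e` even and `j` odd is impossible as
`N - 1` is even; otherwise `k = k₀`. [cite: Mazur1978, proof of Prop. 5.1 (p. 151)] -/
theorem stub_prop51_of_range : ∀ (N : ℕ) [Fact N.Prime], (N = 11 ∨ 17 ≤ N) →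
    ∀ (r χ : absoluteGaloisGroup ℚ →* (ZMod N)ˣ) (k₀ : ℕ),
    (∀ σ : absoluteGaloisGroup ℚ, ∃ b : (ZMod N)ˣ, b ^ 12 = 1 ∧ r σ = b * χ σ ^ k₀) →
    (∃ e ∈ ({1, 2, 3, 4, 6} : Finset ℕ), ∃ j ≤ e, e * k₀ ≡ j [MOD N - 1]) →
    ∃ k : ℕ, (k ≡ 0 [MOD (N - 1) / 2] ∨ k ≡ 1 [MOD (N - 1) / 2] ∨ 2 * k ≡ 1 [MOD (N - 1) / 2] ∨
        3 * k ≡ 1 [MOD (N - 1) / 2] ∨ 3 * k ≡ 2 [MOD (N - 1) / 2]) ∧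
      ∀ σ : absoluteGaloisGroup ℚ, ∃ b : (ZMod N)ˣ, b ^ 12 = 1 ∧ r σ = b * χ σ ^ k := by
  intro N hp hN r χ k₀ hr hrange
  obtain ⟨e, he, j, hj, hmod⟩ := hrange
  -- `N` is an odd prime: `N - 1 = 2m` with `m = (N - 1) / 2`.
  have hN2 : N % 2 = 1 := hp.out.eq_two_or_odd.resolve_left (by omega)
  obtain ⟨m, hm⟩ : ∃ m, N - 1 = 2 * m := ⟨(N - 1) / 2, by omega⟩
  have hmN : (N - 1) / 2 = m := by omega
  have hmod2 : e * k₀ ≡ j [MOD 2 * m] := by rw [← hm]; exact hmod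
  rw [hmN]
  simp only [Finset.mem_insert, Finset.mem_singleton] at he
  -- the twenty-one cases `(e, j)`, `0 ≤ j ≤ e ∈ {1, 2, 3, 4, 6}`: in order, `j = 0` (class
  -- `k ≡ 0`), `j = e` (class `k ≡ 1`), parity contradiction, and the classes with `k = k₀`.
  rcases he with rfl | rfl | rfl | rfl | rfl <;> interval_cases j
  all_goals first
    | exact prop51_class_zero r χ (by norm_num) hmod hr
    | exact prop51_class_one r χ (by norm_num) (by norm_num) (by omega) hmod hr
    | (exfalso
       have h2 := Nat.ModEq.of_mul_right m hmod2
       unfold Nat.ModEq at h2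
       omega)
    | (refine ⟨k₀, ?_, hr⟩
       first
         | exact Or.inr <| Or.inr <| Or.inr <| Or.inl <| hmod2.of_mul_left 2
         | exact Or.inr <| Or.inr <| Or.inr <| Or.inr <| hmod2.of_mul_left 2
         | exact Or.inr <| Or.inr <| Or.inl <| modEq_half_of_modEq_two_mul hmod2 (by omega) rfl
         | exact Or.inr <| Or.inr <| Or.inr <| Or.inl <|
             modEq_half_of_modEq_two_mul hmod2 (by omega) rfl
         | exact Or.inr <| Or.inr <| Or.inr <| Or.inr <|
             modEq_half_of_modEq_two_mul hmod2 (by omega) rfl)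

end Summit.ABC.ABC.Theorems

end
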